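import Literature.NumberTheory.Automorphic.Liu2021.AppendixC.EtaleH1TowerHeckeEndomorphism
import Literature.AlgebraicGeometry.Motives.AbelianVarietyTateModuleFaithful
import HarnessLib

/-!
# An `ℓ`-adic Hecke PIN is the geometric correspondence, up to the isogeny `Alb(u^N_K)` ([Liu2021] §4.2)

Topic `NumberTheory/Automorphic/Liu2021/AppendixC`; namespace `Literature.NumberTheory.Automorphic.Liu2021.AppendixC.Sec42Data.HeckeTranslates`.
THEOREMS ONLY (no definition, no named fact, no instance, no `sorry`).  Cell `hodgecm-mathlib`, FLOOR-0 P5, D9op road 2′: adapter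
**A-L3-5** of the L3-inputs census (`A-provers/A-p05/g15/F0P5/L3-INPUTS-byname-census.A-p05g15.md` §3) for the registered sub-line
`Cruxes/HLiu418/Lines/F0_D9opRoad2.lean` (`stub_L3 : RecordCurveEichlerShimuraModel`).  HC_CM is proved only modulo the 7 printed citations
until rung 0 closes; this file moves no book.

## What is proved

The tree's Hecke dictionary ★ `exists_hom_toTower_dualMap_eq_smul_heckeOperator` PINS the Hecke operator `[KgK]` on the étale tower to an
honest endomorphism `θ` of `A_K` up to a non-zero integer `m`, but only `ℓ`-ADICALLY: `[ᵗV_ℓ(θ) φ]_K = m • [KgK] [φ]_K` for all linear forms `φ`.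
The stub `stub_L3` of the D9op sub-line quantifies over ALL such pins; its prover needs to know that a pin IS the geometric correspondence.
Here: granted injective étale pull-backs (`hI`, ★ `hI_GSM` for the record curve), for any admissible source level `N ⊆ K` and any
representatives `r α` of the cosets `αK ⊆ KgK` with `T_{r α}` defined at `N → K`,

  `Alb(u^N_K) ≫ θ = m • Σ_α Alb(T_{r α})`  in `Hom(A_N, A_K)`  (`atr_comp_eq_smul_sum_albTr_of_pin`),

i.e. the pin is Lang's/Milne's «Hecke correspondence = sum of translates» ([Milne2005ShimuraVarieties] §5 p. 58, §13 p. 118) read on the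
Albanese, up to the isogeny `Alb(u)` and the integer `m`.  Proof: push both sides into the tower at level `N` (`toTower_pull`,
`etHeckeRep_toTower`, `heckeOperator_apply_eq_sum_out`), where they agree by the pin; `[·]_N` is injective (★ `toTower_injective`); linear
forms separate points of `V_ℓ`; `V_ℓ` is faithful on homomorphisms ([Milne1986AbelianVarieties] Lemma 12.2, ★ `hom_ext_of_tateModuleMap_eq`).
Corollary `smul_eq_smul_of_pin_of_pin`: two pins `(θ, m)` at `ℓ` and `(θ′, m′)` at `ℓ′` of the same `[KgK]` satisfy `m′ • θ = m • θ′`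
(granted `Alb(u)` epi) — `ℓ`-independence of the dictionary.  Also the elementary `hom_ext_of_dualMap_rationalTateModuleMap_eq` (`ᵗV_ℓ f = ᵗV_ℓ g ⇒ f = g`).

## References
* [Liu2021] Y. Liu, *Fourier–Jacobi cycles and arithmetic relative trace formula*, Camb. J. Math. 9 (2021), §4.2 (FJcycle.tex l. 2066–2074),
  App. D proof of Cor. D.9 (p. 139).
* [Milne2005ShimuraVarieties] J. Milne, *Introduction to Shimura varieties*, §5 p. 58, §13 p. 118.
* [Milne1986AbelianVarieties] J. S. Milne, *Abelian varieties* (Cornell–Silverman), Lemma 12.2 (p. 189).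
-/

set_option autoImplicit false

noncomputable section

open CategoryTheory NumberField Function MulAction
open scoped TensorProduct

namespace Literature.NumberTheory.Automorphic.Liu2021.AppendixC

open Literature.AlgebraicGeometry.Motives (AbelianVariety)
open Literature.AlgebraicGeometry.Motives.AbelianVariety (tateModuleMap rationalTateModuleMap rationalTateModuleMap_comp rationalTateModuleMap_add
  rationalTateModuleMap_toRational hom_ext_of_tateModuleMap_eq)

/-! ## §1 Linear forms separate `V_ℓ`-realisations of homomorphisms -/

/-- **`ᵗV_ℓ f = ᵗV_ℓ g ⇒ f = g`** for homomorphisms of abelian varieties over a field of characteristic `≠ ℓ`: linear forms separate the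
points of the `ℚ_ℓ`-vector space `V_ℓ`, `T_ℓ ↪ V_ℓ` (★ `TateModule.toRational_injective`), and `T_ℓ` is faithful on homomorphisms
([Milne1986AbelianVarieties] Lemma 12.2, ★ `hom_ext_of_tateModuleMap_eq`). [cite: Milne1986AbelianVarieties, Lemma 12.2 (p. 189)] -/
theorem hom_ext_of_dualMap_rationalTateModuleMap_eq {K : Type} [Field K] (ℓ : ℕ) [Fact ℓ.Prime] (hℓ : (ℓ : K) ≠ 0)
    {X Y : AbelianVariety K} {f g : X ⟶ Y}
    (h : (rationalTateModuleMap ℓ f).dualMap = (rationalTateModuleMap ℓ g).dualMap) : f = g := by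
  refine hom_ext_of_tateModuleMap_eq ℓ hℓ (LinearMap.ext fun x => ?_)
  apply Literature.NumberTheory.EllipticCurves.TateModule.toRational_injective (p := ℓ)
  rw [← rationalTateModuleMap_toRational, ← rationalTateModuleMap_toRational]
  -- linear forms separate points of `V_ℓ Y`
  refine sub_eq_zero.1 ((Module.forall_dual_apply_eq_zero_iff ℚ_[ℓ]
    (rationalTateModuleMap ℓ f (Literature.NumberTheory.EllipticCurves.TateModule.toRational ℓ x) -
      rationalTateModuleMap ℓ g (Literature.NumberTheory.EllipticCurves.TateModule.toRational ℓ x))).1 fun φ => ?_)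
  rw [map_sub, sub_eq_zero]
  exact LinearMap.congr_fun (LinearMap.congr_fun h φ) _

variable {F E : Type} [Field F] [NumberField F] [IsTotallyReal F] [Field E] [NumberField E] [Algebra F E]
  [IsTotallyComplex E] [Algebra.IsQuadraticExtension F E]
variable {P5 : PropC5Data F E} {isotropicAt : ℕ → Prop}

namespace Sec42Data.HeckeTranslates

variable {C : Sec42Data P5 isotropicAt} (T : C.HeckeTranslates) (ℓ : ℕ) [Fact ℓ.Prime]

/-! ## §2 The pin is the sum of the translates, up to `Alb(u)` and `m` -/

/-- **An `ℓ`-adic pin of `[KgK]` is the geometric Hecke correspondence up to the isogeny `Alb(u^N_K)`.**  Let `hI` be injectivity of the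
étale pull-backs, `N ⊆ K` small levels, `r α` representatives of the cosets `α = yK ⊆ KgK` (`(r α : G⧸K) = α`) such that every translate
`T_{r α} : X_N → X_K` is defined (`C5.HeckeLE (r α) N K`), and `(θ, m)` a PIN of `[KgK]` at level `K`:
`[ᵗV_ℓ(θ) φ]_K = m • [KgK] [φ]_K` for all `φ ∈ (V_ℓ A_K)^∨` (the ∃-body of ★ `exists_hom_toTower_dualMap_eq_smul_heckeOperator`).  Then
`Alb(u^N_K) ≫ θ = m • Σ_α Alb(T_{r α})` in `Hom(A_N, A_K)` — «the Hecke correspondence is the sum of the translates `T(g)`»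
([Milne2005ShimuraVarieties] §5 p. 58) read on the Albanese.
[cite: Liu2021, §4.2 (FJcycle.tex l. 2066–2074)] [cite: Milne2005ShimuraVarieties, §5 p. 58 and §13 p. 118] -/
theorem atr_comp_eq_smul_sum_albTr_of_pin
    (hI : ∀ ⦃K K' : C5.SmallLevel C.S.K₀⦄ (f : K' ⟶ K), Function.Injective (rationalTateModuleMap ℓ (C.Atr f)).dualMap)
    (K N : C5.SmallLevel C.S.K₀) (hNK : N ≤ K) (g : C.G)
    [Fintype (orbit (K.1.1 : Subgroup C.G) (g : C.G ⧸ (K.1.1 : Subgroup C.G)))]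
    (r : orbit (K.1.1 : Subgroup C.G) (g : C.G ⧸ (K.1.1 : Subgroup C.G)) → C.G)
    (hr : ∀ α, ((r α : C.G) : C.G ⧸ (K.1.1 : Subgroup C.G)) = α.1) (hrN : ∀ α, C5.HeckeLE (r α) N K)
    {m : ℤ} {θ : C.A K ⟶ C.A K}
    (hθ : ∀ φ : C.etaleH1 ℓ K, C.toTower ℓ K ((rationalTateModuleMap ℓ θ).dualMap φ) =
      (m : ℚ_[ℓ]) • Literature.NumberTheory.Automorphic.heckeOperator (T.etHeckeRep ℓ) (K.1.1 : Subgroup C.G) g (C.toTower ℓ K φ)) :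
    C.Atr (homOfLE hNK) ≫ θ = m • ∑ α, T.albTr (r α) N K (hrN α) := by
  classical
  have hℓ : (ℓ : E) ≠ 0 := Nat.cast_ne_zero.2 (Fact.out : ℓ.Prime).ne_zero
  refine hom_ext_of_dualMap_rationalTateModuleMap_eq ℓ hℓ (LinearMap.ext fun φ => C.toTower_injective ℓ hI N ?_)
  -- left: push to level `K`, apply the pin, expand the Hecke operator over the cosets
  have hfin : (orbit (K.1.1 : Subgroup C.G) (g : C.G ⧸ (K.1.1 : Subgroup C.G))).Finite := Set.toFinite _
  have hfix : C.toTower ℓ K φ ∈ (T.etHeckeRep ℓ).fixedPoints (K.1.1 : Subgroup C.G) :=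
    ((T.etHeckeRep ℓ).mem_fixedPoints K.1.1 (C.toTower ℓ K φ)).2 fun _ hk => T.etHeckeRep_toTower_of_mem ℓ hk φ
  -- each canonical representative `α.out` differs from `r α` by an element of `K`, which fixes `[φ]_K`
  have hout : ∀ α : orbit (K.1.1 : Subgroup C.G) (g : C.G ⧸ (K.1.1 : Subgroup C.G)),
      T.etHeckeRep ℓ α.1.out (C.toTower ℓ K φ) = T.etHeckeRep ℓ (r α) (C.toTower ℓ K φ) := by
    intro α
    have hmem : (r α)⁻¹ * α.1.out ∈ (K.1.1 : Subgroup C.G) := by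
      rw [← QuotientGroup.eq, hr α, QuotientGroup.out_eq']
    have e : α.1.out = r α * ((r α)⁻¹ * α.1.out) := by rw [mul_inv_cancel_left]
    rw [e, map_mul, Module.End.mul_apply, ((T.etHeckeRep ℓ).mem_fixedPoints K.1.1 _).1 hfix _ hmem]
  have lhs : C.toTower ℓ N ((rationalTateModuleMap ℓ (C.Atr (homOfLE hNK) ≫ θ)).dualMap φ) =
      (m : ℚ_[ℓ]) • ∑ α, C.toTower ℓ N ((rationalTateModuleMap ℓ (T.albTr (r α) N K (hrN α))).dualMap φ) := by
    rw [rationalTateModuleMap_comp, ← LinearMap.dualMap_comp_dualMap, LinearMap.comp_apply, C.toTower_pull ℓ (homOfLE hNK), hθ φ,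
      Literature.NumberTheory.Automorphic.heckeOperator_apply_eq_sum_out (T.etHeckeRep ℓ) (K.1.1 : Subgroup C.G) g hfin hfix,
      ← Finset.sum_coe_sort hfin.toFinset]
    congr 1
    refine Fintype.sum_equiv (Equiv.subtypeEquivRight fun x => hfin.mem_toFinset) _ _ fun α => ?_
    rw [← T.etHeckeRep_toTower ℓ (r _) (hrN _) φ]
    exact hout ⟨α.1, hfin.mem_toFinset.1 α.2⟩
  -- right: additivity of `V_ℓ`
  let Vh : (C.A N ⟶ C.A K) →+ ((C.A N).rationalTateModule ℓ →ₗ[ℚ_[ℓ]] (C.A K).rationalTateModule ℓ) :=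
    AddMonoidHom.mk' (fun f => rationalTateModuleMap ℓ f) (rationalTateModuleMap_add ℓ)
  have rhs : C.toTower ℓ N ((rationalTateModuleMap ℓ (m • ∑ α, T.albTr (r α) N K (hrN α))).dualMap φ) =
      (m : ℚ_[ℓ]) • ∑ α, C.toTower ℓ N ((rationalTateModuleMap ℓ (T.albTr (r α) N K (hrN α))).dualMap φ) := by
    have e1 : rationalTateModuleMap ℓ (m • ∑ α, T.albTr (r α) N K (hrN α)) =
        m • ∑ α, rationalTateModuleMap ℓ (T.albTr (r α) N K (hrN α)) := by
      show Vh (m • ∑ α, T.albTr (r α) N K (hrN α)) = _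
      rw [map_zsmul, map_sum]
      rfl
    have e2 : (rationalTateModuleMap ℓ (m • ∑ α, T.albTr (r α) N K (hrN α))).dualMap φ =
        (m : ℚ_[ℓ]) • ∑ α, (rationalTateModuleMap ℓ (T.albTr (r α) N K (hrN α))).dualMap φ := by
      apply LinearMap.ext
      intro v
      rw [LinearMap.dualMap_apply, e1, LinearMap.smul_apply, LinearMap.sum_apply, map_zsmul, map_sum, LinearMap.smul_apply,
        LinearMap.sum_apply, ← Int.cast_smul_eq_zsmul ℚ_[ℓ] m]
      congr 1
    rw [e2, map_smul, map_sum]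
  rw [lhs, rhs]


/-- **Two pins of the same Hecke operator agree up to their integers — across primes `ℓ, ℓ′` as well**: if `(θ, m)` pins `[KgK]` on the
`ℓ`-adic tower and `(θ′, m′)` pins it on the `ℓ′`-adic tower, then `m′ • θ = m • θ′` in `End(A_K)` (both `Alb(u) ≫ θ`, `Alb(u) ≫ θ′` are
the integer multiples `m`, `m′` of the SAME sum of translates, and `Alb(u^N_K)` is an epimorphism — ★ `albTransitionEpi_GSM` for the
record curve).  This is the `ℓ`-independence ∕ uniqueness-up-to-scaling of the Hecke dictionary that the prover of `stub_L3` needs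
when the stub quantifies over ALL pins. [cite: Liu2021, §4.2 (FJcycle.tex l. 2066–2074)] [cite: Milne2005ShimuraVarieties, §5 p. 58] -/
theorem smul_eq_smul_of_pin_of_pin {ℓ' : ℕ} [Fact ℓ'.Prime]
    (hI : ∀ ⦃K K' : C5.SmallLevel C.S.K₀⦄ (f : K' ⟶ K), Function.Injective (rationalTateModuleMap ℓ (C.Atr f)).dualMap)
    (hI' : ∀ ⦃K K' : C5.SmallLevel C.S.K₀⦄ (f : K' ⟶ K), Function.Injective (rationalTateModuleMap ℓ' (C.Atr f)).dualMap)
    (K N : C5.SmallLevel C.S.K₀) (hNK : N ≤ K) [Epi (C.Atr (homOfLE hNK))] (g : C.G)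
    [Fintype (orbit (K.1.1 : Subgroup C.G) (g : C.G ⧸ (K.1.1 : Subgroup C.G)))]
    (r : orbit (K.1.1 : Subgroup C.G) (g : C.G ⧸ (K.1.1 : Subgroup C.G)) → C.G)
    (hr : ∀ α, ((r α : C.G) : C.G ⧸ (K.1.1 : Subgroup C.G)) = α.1) (hrN : ∀ α, C5.HeckeLE (r α) N K)
    {m m' : ℤ} {θ θ' : C.A K ⟶ C.A K}
    (hθ : ∀ φ : C.etaleH1 ℓ K, C.toTower ℓ K ((rationalTateModuleMap ℓ θ).dualMap φ) =
      (m : ℚ_[ℓ]) • Literature.NumberTheory.Automorphic.heckeOperator (T.etHeckeRep ℓ) (K.1.1 : Subgroup C.G) g (C.toTower ℓ K φ))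
    (hθ' : ∀ φ : C.etaleH1 ℓ' K, C.toTower ℓ' K ((rationalTateModuleMap ℓ' θ').dualMap φ) =
      (m' : ℚ_[ℓ']) • Literature.NumberTheory.Automorphic.heckeOperator (T.etHeckeRep ℓ') (K.1.1 : Subgroup C.G) g (C.toTower ℓ' K φ)) :
    m' • θ = m • θ' := by
  have h1 := T.atr_comp_eq_smul_sum_albTr_of_pin ℓ hI K N hNK g r hr hrN hθ
  have h2 := T.atr_comp_eq_smul_sum_albTr_of_pin ℓ' hI' K N hNK g r hr hrN hθ'
  rw [← cancel_epi (C.Atr (homOfLE hNK)), Preadditive.comp_zsmul, Preadditive.comp_zsmul, h1, h2, smul_smul, smul_smul, mul_comm]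

end Sec42Data.HeckeTranslates

end Literature.NumberTheory.Automorphic.Liu2021.AppendixC

end
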